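import Summits.SmoothPoincare4.SmoothPoincare4.Theses.EntropyRung
import Literature.Geometry.Lorentzian.VolumeChartIntegral
import Literature.Geometry.Lorentzian.EnergyCurrents
import Literature.Geometry.Lorentzian.ChartCalculus
import Summits.SmoothPoincare4.SmoothPoincare4.Theorems.EntropyRungSubcylindricalExistenceCapClauseEuclideanSchwarzschildAux
import Mathlib.Analysis.Calculus.Gradient.Basic
import HarnessLib

/-!
# The exact cone `c'²‖x‖^{2c'−2} δ` on `ℝ⁴`: `|∇u|²` and `dV` in Euclidean terms, and the
# log-Sobolev floor near infinity
(aux for stub `helper_annulusConeFloor`, line `fat-conical-core-avr-logsobolev`, crux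
`EntropyRung.SubcylindricalExistence`, stmt-SmoothPoincare4-10871)

For a smooth Riemannian metric `g` on `ℝ⁴ = EuclideanSpace ℝ (Fin 4)` (a manifold over itself,
`I = 𝓡 4`, `extChartAt = id`) which at a point `x` is conformal to the flat metric,
`g_x = φ ⟪·,·⟫`, we read the tree's `|∇f|²_g(x) = g⁻¹(df, df)` as `φ⁻¹ ‖∇f(x)‖²` (Euclidean
gradient; `♯ df = φ⁻¹ ∇f`) and the chart Gram matrix as `φ · 1`, so that the Riemannian measure
(`riemannianMeasure`, `= √det g_{ij} dy` by `integral_eq_integral_chart`) of a function supported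
where `g = ψ² δ` is `ψ⁴ dx`. Consequently, if `g` equals the cone metric `(c'‖x‖^{c'−1})² δ` on
`{1 ≤ ‖x‖}` and satisfies the scale-family log-Sobolev inequality
`∫ u² log u² dV ≤ 4τ ∫ |∇u|² dV − 3 log c' − 2 log(4πτ) − 4` (`∫ u² dV = 1`, all `τ > 0`), then
for every smooth compactly supported `w` with `tsupport w ⊆ {1 < ‖x‖}` and
`∫ (4πτ)⁻² w² ψ⁴ dx = 1`, `ψ = c'‖x‖^{c'−1}`:
`3 log c' ≤ ∫ [4τ ψ⁻² ‖∇w‖² − w² log w² − 4 w²] (4πτ)⁻² ψ⁴ dx` (substitute `u = (4πτ)⁻¹ w`).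
The registered helper `helper_helper_annulusConeFloor_cone` feeds this with the
Balogh–Kristály–Tripaldi inequality (hypothesis) on the smoothed cone model (hypothesis).
Everything is proved; no definition, no named fact.

References: Z. M. Balogh, A. Kristály, F. Tripaldi, *Sharp log-Sobolev inequalities in `CD(0,N)`
spaces with applications*, J. Funct. Anal. 286 (2024) [BaloghKristalyTripaldi2024], Thm. 1.1;
I. Chavel, *Riemannian Geometry* (2006), §III.3 (III.3.6) [Chavel2006]; B. O'Neill,
*Semi-Riemannian geometry* (1983), Ch. 3, p. 60 [ONeill1983].
-/

noncomputable section

open scoped Manifold ContDiff Topology ENNReal NNReal RealInnerProductSpace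
open Set Filter Function MeasureTheory InnerProductSpace
open Literature.Geometry.Lorentzian

-- the registered namespace `Summit.SmoothPoincare4.SmoothPoincare4.Theorems` repeats a component
set_option linter.dupNamespace false

namespace Summit.SmoothPoincare4.SmoothPoincare4.Theorems

namespace AnnulusConeFloor

variable {n : ℕ∞ω}

/-! ## `ℝ⁴` as a manifold over itself: the chart is the identity -/

/-- On the model space the inverse extended chart is the identity, so its differential is the
identity. [folklore] -/
theorem mfderiv_extChartAt_symm_self (p y X : EuclideanSpace ℝ (Fin 4)) :
    mfderiv 𝓘(ℝ, EuclideanSpace ℝ (Fin 4)) (𝓡 4) (extChartAt (𝓡 4) p).symm y X = X := by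
  rw [extChartAt_model_space_eq_id, PartialEquiv.refl_symm, PartialEquiv.refl_coe, mfderiv_id]
  rfl

/-- On the model space the inverse extended chart is the identity. [folklore] -/
theorem extChartAt_symm_self_apply (p y : EuclideanSpace ℝ (Fin 4)) :
    (extChartAt (𝓡 4) p).symm y = y := by
  rw [extChartAt_model_space_eq_id, PartialEquiv.refl_symm, PartialEquiv.refl_coe, id]

/-- `mvfderiv` on `ℝ⁴` pairs with a vector as the Euclidean gradient:
`df_x X = ⟪∇f(x), X⟫`. [folklore] -/
theorem mvfderiv_apply_eq_inner_gradient (f : EuclideanSpace ℝ (Fin 4) → ℝ)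
    (x X : EuclideanSpace ℝ (Fin 4)) : mvfderiv (𝓡 4) f x X = ⟪gradient f x, X⟫ := by
  rw [gradient, toDual_symm_apply]
  simp only [mvfderiv, ContinuousLinearMap.comp_apply, mfderiv_eq_fderiv]
  rfl

/-! ## `|∇f|²_g` and `√det g_{ij}` of a metric conformal to `δ` at a point -/

/-- **`|∇f|²_g = φ⁻¹ ‖∇f‖²` at a point where `g = φ δ`** (`♯ df = φ⁻¹ ∇f` by uniqueness of `♯`).
O'Neill 1983, Ch. 3, p. 60. [folklore] -/
theorem gradSq_of_conformal_flat_at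
    (g : PseudoRiemannianMetric (𝓡 4) n (EuclideanSpace ℝ (Fin 4))
      (TangentSpace (𝓡 4) : EuclideanSpace ℝ (Fin 4) → Type _))
    {x : EuclideanSpace ℝ (Fin 4)} {φ : ℝ} (hφ : φ ≠ 0)
    (hconf : ∀ v w : EuclideanSpace ℝ (Fin 4), g.val x v w = φ * ⟪v, w⟫)
    (f : EuclideanSpace ℝ (Fin 4) → ℝ) :
    g.gradSq f x = φ⁻¹ * ‖gradient f x‖ ^ 2 := by
  have hsharp : g.sharp x
      (mvfderiv (𝓡 4) f x : TangentSpace (𝓡 4) x →ₗ[ℝ] ℝ) = φ⁻¹ • gradient f x := by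
    refine PseudoRiemannianMetric.sharp_eq_of_forall g _ _ _ fun w ↦ ?_
    rw [ContinuousLinearMap.coe_coe, mvfderiv_apply_eq_inner_gradient, hconf,
      real_inner_smul_left, ← mul_assoc, mul_inv_cancel₀ hφ, one_mul]
  rw [PseudoRiemannianMetric.gradSq_eq, hsharp, mvfderiv_apply_eq_inner_gradient,
    real_inner_smul_right, real_inner_self_eq_norm_sq]

/-- `|∇f|²_g(x) = 0` if `f` vanishes near `x`. [folklore] -/
theorem gradSq_eq_zero_of_eventuallyEq
    (g : PseudoRiemannianMetric (𝓡 4) n (EuclideanSpace ℝ (Fin 4))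
      (TangentSpace (𝓡 4) : EuclideanSpace ℝ (Fin 4) → Type _))
    {f : EuclideanSpace ℝ (Fin 4) → ℝ} {x : EuclideanSpace ℝ (Fin 4)} (hf : f =ᶠ[𝓝 x] 0) :
    g.gradSq f x = 0 := by
  have h : mvfderiv (𝓡 4) f x = 0 := by
    ext X
    rw [mvfderiv_apply_eq_inner_gradient, hf.gradient_eq]
    simp [Pi.zero_def, gradient_fun_const]
  simp [PseudoRiemannianMetric.gradSq, h, PseudoRiemannianMetric.innerDual]

/-- **The chart Gram matrix at a point where `g = φ δ` is `φ · 1`.** [folklore] -/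
theorem chartGramMatrix_of_conformal_flat_at
    (g : PseudoRiemannianMetric (𝓡 4) n (EuclideanSpace ℝ (Fin 4))
      (TangentSpace (𝓡 4) : EuclideanSpace ℝ (Fin 4) → Type _)) (hg : g.IsRiemannian)
    (p : EuclideanSpace ℝ (Fin 4)) {y : EuclideanSpace ℝ (Fin 4)} {φ : ℝ}
    (hconf : ∀ v w : EuclideanSpace ℝ (Fin 4), g.val y v w = φ * ⟪v, w⟫) :
    chartGramMatrix (g.toContMDiffRiemannianMetric hg) p y =
      φ • (1 : Matrix (Fin 4) (Fin 4) ℝ) := by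
  ext i j
  simp only [chartGramMatrix, Matrix.of_apply, Matrix.smul_apply, smul_eq_mul,
    PseudoRiemannianMetric.toContMDiffRiemannianMetric_inner]
  have hrange : range (𝓡 4) = univ := (𝓡 4).range_eq_univ
  rw [hrange, mfderivWithin_univ, mfderiv_extChartAt_symm_self, mfderiv_extChartAt_symm_self,
    extChartAt_symm_self_apply, hconf, Matrix.one_apply, EuclideanSpace.inner_single_left,
    PiLp.single_apply]
  simp

/-- Hence **the Riemannian density at a point where `g = ψ² δ` is `ψ⁴`** (`ψ ≥ 0`).
[cite: Chavel2006, §III.3 (III.3.5)] -/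
theorem sqrt_det_chartGramMatrix_of_conformal_flat_at
    (g : PseudoRiemannianMetric (𝓡 4) n (EuclideanSpace ℝ (Fin 4))
      (TangentSpace (𝓡 4) : EuclideanSpace ℝ (Fin 4) → Type _)) (hg : g.IsRiemannian)
    (p : EuclideanSpace ℝ (Fin 4)) {y : EuclideanSpace ℝ (Fin 4)} {ψ : ℝ} (hψ : 0 ≤ ψ)
    (hconf : ∀ v w : EuclideanSpace ℝ (Fin 4), g.val y v w = ψ ^ 2 * ⟪v, w⟫) :
    Real.sqrt (chartGramMatrix (g.toContMDiffRiemannianMetric hg) p y).det = ψ ^ 4 := by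
  rw [chartGramMatrix_of_conformal_flat_at g hg p hconf, Matrix.det_smul, Matrix.det_one, mul_one,
    Fintype.card_fin, show (ψ ^ 2) ^ 4 = (ψ ^ 4) ^ 2 by ring, Real.sqrt_sq (pow_nonneg hψ 4)]

/-- **The Riemannian integral of a function supported where `g = ψ² δ` is `∫ F ψ⁴ dx`**: the
chart formula `∫ F dV_g = ∫ √det g_{ij} F dy` (Chavel 2006, (III.3.6)) in the identity chart of
`ℝ⁴`, with `√det g_{ij} = ψ⁴` on the support. [cite: Chavel2006, §III.3 (III.3.6)] -/
theorem integral_riemannianMeasure_eq_of_conformal_flat_on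
    (g : PseudoRiemannianMetric (𝓡 4) n (EuclideanSpace ℝ (Fin 4))
      (TangentSpace (𝓡 4) : EuclideanSpace ℝ (Fin 4) → Type _)) (hg : g.IsRiemannian)
    {U : Set (EuclideanSpace ℝ (Fin 4))} {ψ : EuclideanSpace ℝ (Fin 4) → ℝ} (hψ : ∀ y ∈ U, 0 ≤ ψ y)
    (hconf : ∀ y ∈ U, ∀ v w : EuclideanSpace ℝ (Fin 4), g.val y v w = ψ y ^ 2 * ⟪v, w⟫)
    {F : EuclideanSpace ℝ (Fin 4) → ℝ} (hF : Measurable F) (hFU : support F ⊆ U) :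
    ∫ x, F x ∂(riemannianMeasure (g.toContMDiffRiemannianMetric hg)) = ∫ x, F x * ψ x ^ 4 := by
  have h := integral_eq_integral_chart (g.toContMDiffRiemannianMetric hg)
    (0 : EuclideanSpace ℝ (Fin 4)) hF (by rw [extChartAt_source]; simp)
  have ht : (extChartAt (𝓡 4) (0 : EuclideanSpace ℝ (Fin 4))).target = univ := by
    rw [extChartAt_model_space_eq_id, PartialEquiv.refl_target]
  rw [h, ht, setIntegral_univ]
  refine integral_congr_ae (ae_of_all _ fun y ↦ ?_)
  simp only [extChartAt_symm_self_apply, smul_eq_mul]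
  by_cases hy : F y = 0
  · simp [hy]
  · rw [sqrt_det_chartGramMatrix_of_conformal_flat_at g hg 0 (hψ y (hFU hy)) (hconf y (hFU hy)),
      mul_comm]

/-! ## Euclidean bookkeeping -/

/-- A product `A · B` with `A` continuous, `tsupport A ⊆ U` open, and `B` continuous on `U`, is
continuous (it vanishes near every point off `U`). [folklore] -/
theorem continuous_mul_of_tsupport_subset {A B : EuclideanSpace ℝ (Fin 4) → ℝ}
    {U : Set (EuclideanSpace ℝ (Fin 4))} (hU : IsOpen U) (hA : Continuous A) (hAU : tsupport A ⊆ U)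
    (hB : ContinuousOn B U) : Continuous fun x ↦ A x * B x := by
  rw [continuous_iff_continuousAt]
  intro x
  by_cases hx : x ∈ U
  · exact hA.continuousAt.mul (hB.continuousAt (hU.mem_nhds hx))
  · have h0 : A =ᶠ[𝓝 x] 0 := notMem_tsupport_iff_eventuallyEq.mp fun h ↦ hx (hAU h)
    have h1 : (fun y ↦ A y * B y) =ᶠ[𝓝 x] fun _ ↦ 0 := h0.mono fun y hy ↦ by simp [hy]
    exact (continuousAt_congr h1).mpr continuousAt_const

/-- Integrability of `A · B` for `A` continuous with `support A ⊆ tsupport w`, `w` compactly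
supported in the open set `U`, and `B` continuous on `U`. [folklore] -/
theorem integrable_mul_of_support_subset {w A B : EuclideanSpace ℝ (Fin 4) → ℝ}
    {U : Set (EuclideanSpace ℝ (Fin 4))} (hU : IsOpen U) (hw : HasCompactSupport w)
    (hwU : tsupport w ⊆ U) (hA : Continuous A) (hAw : support A ⊆ tsupport w)
    (hB : ContinuousOn B U) : Integrable (fun x ↦ A x * B x) := by
  have hAt : tsupport A ⊆ tsupport w := closure_minimal hAw (isClosed_tsupport w)
  have hAc : HasCompactSupport A := hw.mono' hAw
  exact (continuous_mul_of_tsupport_subset hU hA (hAt.trans hwU) hB).integrable_of_hasCompactSupport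
    hAc.mul_right

/-- `support (∇f) ⊆ tsupport f`. [folklore] -/
theorem support_gradient_subset (f : EuclideanSpace ℝ (Fin 4) → ℝ) :
    support (gradient f) ⊆ tsupport f := fun x hx ↦ by
  by_contra h
  exact hx (CapClauseEuclideanSchwarzschildAux.gradient_eq_zero_of_notMem h)

/-- `(4πτ)^{-4/2} = ((4πτ)⁻¹)²` for `τ > 0`. [folklore] -/
theorem gaussNorm_eq {τ : ℝ} (hτ : 0 < τ) :
    (4 * Real.pi * τ) ^ (-(4 : ℝ) / 2) = ((4 * Real.pi * τ)⁻¹) ^ 2 := by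
  have h : 0 < 4 * Real.pi * τ := by positivity
  rw [show (-(4 : ℝ) / 2) = -(2 : ℕ) by norm_num, Real.rpow_neg h.le, Real.rpow_natCast, inv_pow]

/-! ## The cone metric on `{1 ≤ ‖x‖}`: gradient, measure, and the floor near infinity -/

section Cone

variable (g : PseudoRiemannianMetric (𝓡 4) ∞ (EuclideanSpace ℝ (Fin 4))
    (TangentSpace (𝓡 4) : EuclideanSpace ℝ (Fin 4) → Type _)) (hg : g.IsRiemannian) {c' : ℝ}
  (hc' : 0 < c')
  (hcone : ∀ x : EuclideanSpace ℝ (Fin 4), 1 ≤ ‖x‖ → ∀ v w : EuclideanSpace ℝ (Fin 4),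
    g.val x v w = (c' * ‖x‖ ^ (c' - 1)) ^ 2 * ⟪v, w⟫)

include hc' in
/-- The cone weight `ψ = c'‖x‖^{c'−1}` is positive off the origin. [folklore] -/
theorem coneWeight_pos {x : EuclideanSpace ℝ (Fin 4)} (hx : x ≠ 0) : 0 < c' * ‖x‖ ^ (c' - 1) :=
  mul_pos hc' (Real.rpow_pos_of_pos (norm_pos_iff.mpr hx) _)

/-- The cone weight is continuous on `{1 < ‖x‖}`. [folklore] -/
theorem continuousOn_coneWeight (c' : ℝ) :
    ContinuousOn (fun x : EuclideanSpace ℝ (Fin 4) ↦ c' * ‖x‖ ^ (c' - 1)) {x | 1 < ‖x‖} :=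
  continuousOn_const.mul (continuous_norm.continuousOn.rpow_const fun x hx ↦
    Or.inl (by have : (1 : ℝ) < ‖x‖ := hx; positivity))

include hc' hcone in
/-- **`|∇u|²_g = ψ⁻² ‖∇u‖²` everywhere for `u` supported in `{1 < ‖x‖}`** (`ψ = c'‖x‖^{c'−1}`;
off the support both sides vanish). [folklore] -/
theorem gradSq_cone_eq {u : EuclideanSpace ℝ (Fin 4) → ℝ} (hu : tsupport u ⊆ {x | 1 < ‖x‖})
    (x : EuclideanSpace ℝ (Fin 4)) :
    g.gradSq u x = (c' * ‖x‖ ^ (c' - 1))⁻¹ ^ 2 * ‖gradient u x‖ ^ 2 := by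
  by_cases hx : x ∈ tsupport u
  · have h1 : 1 < ‖x‖ := hu hx
    have hx0 : x ≠ 0 := by
      rintro rfl
      norm_num at h1
    rw [gradSq_of_conformal_flat_at g (pow_pos (coneWeight_pos hc' hx0) 2).ne' (hcone x h1.le) u,
      inv_pow]
  · rw [gradSq_eq_zero_of_eventuallyEq g (notMem_tsupport_iff_eventuallyEq.mp hx),
      CapClauseEuclideanSchwarzschildAux.gradient_eq_zero_of_notMem hx, norm_zero]
    ring

include hc' hcone in
/-- **`∫ F dV_g = ∫ F ψ⁴ dx` for `F` measurable with `support F ⊆ {1 < ‖x‖}`.**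
[cite: Chavel2006, §III.3 (III.3.6)] -/
theorem integral_cone_eq {F : EuclideanSpace ℝ (Fin 4) → ℝ} (hF : Measurable F)
    (hFU : support F ⊆ {x | 1 < ‖x‖}) :
    ∫ x, F x ∂(riemannianMeasure (g.toContMDiffRiemannianMetric hg)) =
      ∫ x, F x * (c' * ‖x‖ ^ (c' - 1)) ^ 4 :=
  integral_riemannianMeasure_eq_of_conformal_flat_on g hg (U := {x | 1 < ‖x‖})
    (ψ := fun x ↦ c' * ‖x‖ ^ (c' - 1))
    (fun x hx ↦ (coneWeight_pos hc' (by rintro rfl; norm_num at hx)).le)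
    (fun x hx v w ↦ hcone x (le_of_lt hx) v w) hF hFU


variable [g.HasLeviCivita]
  (hLS : ∀ u : EuclideanSpace ℝ (Fin 4) → ℝ, ContMDiff (𝓡 4) 𝓘(ℝ, ℝ) ∞ u → HasCompactSupport u →
    ∫ x, (u x) ^ 2 ∂(riemannianMeasure (g.toContMDiffRiemannianMetric hg)) = 1 →
    ∀ τ : ℝ, 0 < τ →
      ∫ x, (u x) ^ 2 * Real.log ((u x) ^ 2) ∂(riemannianMeasure (g.toContMDiffRiemannianMetric hg)) ≤
        4 * τ * ∫ x, g.gradSq u x ∂(riemannianMeasure (g.toContMDiffRiemannianMetric hg))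
          - 3 * Real.log c' - 2 * Real.log (4 * Real.pi * τ) - 4)

include hc' hcone hLS in
omit [g.HasLeviCivita] in
/-- **The log-Sobolev inequality of the cone read in Euclidean terms**: for `u` smooth, compactly
supported in `{1 < ‖x‖}` with `∫ u² ψ⁴ dx = 1`,
`∫ u² log u² ψ⁴ dx ≤ 4τ ∫ ψ⁻² ‖∇u‖² ψ⁴ dx − 3 log c' − 2 log(4πτ) − 4`.
[cite: BaloghKristalyTripaldi2024, Thm. 1.1] -/
theorem logSobolev_cone_euclidean {u : EuclideanSpace ℝ (Fin 4) → ℝ} (hu : ContDiff ℝ ∞ u)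
    (huc : HasCompactSupport u) (hus : tsupport u ⊆ {x | 1 < ‖x‖})
    (hnorm : ∫ x, (u x) ^ 2 * (c' * ‖x‖ ^ (c' - 1)) ^ 4 = 1) {τ : ℝ} (hτ : 0 < τ) :
    ∫ x, (u x) ^ 2 * Real.log ((u x) ^ 2) * (c' * ‖x‖ ^ (c' - 1)) ^ 4 ≤
      4 * τ * (∫ x, (c' * ‖x‖ ^ (c' - 1))⁻¹ ^ 2 * ‖gradient u x‖ ^ 2 * (c' * ‖x‖ ^ (c' - 1)) ^ 4)
        - 3 * Real.log c' - 2 * Real.log (4 * Real.pi * τ) - 4 := by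
  have huc' : Continuous u := hu.continuous
  have hm2 : Measurable fun x ↦ (u x) ^ 2 := (huc'.pow 2).measurable
  have hsupp2 : support (fun x ↦ (u x) ^ 2) ⊆ {x | 1 < ‖x‖} := fun x hx ↦
    hus (subset_tsupport _ (by simpa using hx))
  have hsuppl : support (fun x ↦ (u x) ^ 2 * Real.log ((u x) ^ 2)) ⊆ {x | 1 < ‖x‖} := fun x hx ↦
    hus (subset_tsupport _ fun h ↦ hx (by simp [h]))
  have hgrad : g.gradSq u = fun x ↦ (c' * ‖x‖ ^ (c' - 1))⁻¹ ^ 2 * ‖gradient u x‖ ^ 2 :=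
    funext (gradSq_cone_eq g hc' hcone hus)
  have hsuppg : support (g.gradSq u) ⊆ {x | 1 < ‖x‖} := fun x hx ↦ by
    rw [mem_support, gradSq_cone_eq g hc' hcone hus x] at hx
    exact hus (support_gradient_subset u fun h ↦ hx (by simp [h]))
  have hmg : Measurable (g.gradSq u) := by
    rw [hgrad]
    have hgc : Continuous (gradient u) :=
      (InnerProductSpace.toDual ℝ (EuclideanSpace ℝ (Fin 4))).symm.continuous.comp
        (hu.continuous_fderiv (by simp))
    exact ((measurable_const.mul (measurable_norm.pow_const _)).inv.pow_const _).mul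
      (hgc.norm.measurable.pow_const _)
  have h1 : ∫ x, (u x) ^ 2 ∂(riemannianMeasure (g.toContMDiffRiemannianMetric hg)) = 1 := by
    rw [integral_cone_eq g hg hc' hcone (F := fun x ↦ (u x) ^ 2) hm2 hsupp2]
    exact hnorm
  have key := hLS u hu.contMDiff huc h1 τ hτ
  rw [integral_cone_eq g hg hc' hcone (F := fun x ↦ (u x) ^ 2 * Real.log ((u x) ^ 2))
      (hm2.mul (Real.measurable_log.comp hm2)) hsuppl,
    integral_cone_eq g hg hc' hcone (F := g.gradSq u) hmg hsuppg] at key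
  simpa only [hgrad] using key

end Cone

end AnnulusConeFloor

/-- **Aux helper `helper_helper_annulusConeFloor_model` (registered) — the log-Sobolev inequality of
the exact cone read in Euclidean coordinates near infinity.** Feeding the scale-family
Balogh–Kristály–Tripaldi inequality on complete `Ric ≥ 0` four-manifolds of asymptotic volume ratio
`θ` (hypothesis) with the smoothed cone model of slope `c'` on `ℝ⁴` (hypothesis: complete,
`Ric ≥ 0`, `AVR = c'³`, equal to `(c'‖x‖^{c'−1})² δ` on `{1 ≤ ‖x‖}`), every smooth compactly
supported `u` with `tsupport u ⊆ {1 < ‖x‖}` and `∫ u² ψ⁴ dx = 1`, `ψ = c'‖x‖^{c'−1}`, satisfies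
`∫ u² log u² ψ⁴ dx ≤ 4τ ∫ ψ⁻² ‖∇u‖² ψ⁴ dx − 3 log c' − 2 log(4πτ) − 4` for all `τ > 0`
(`dV = ψ⁴ dx` and `|∇u|² = ψ⁻² ‖∇u‖²` there, `log c'³ = 3 log c'`).
[cite: BaloghKristalyTripaldi2024, Thm. 1.1] -/
theorem helper_helper_annulusConeFloor_model :
    (∀ (P : Type) [TopologicalSpace P] [T2Space P] [SecondCountableTopology P]
      [ChartedSpace (EuclideanSpace ℝ (Fin 4)) P] [IsManifold (𝓡 4) ∞ P] [ConnectedSpace P]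
      [T3Space P] [MeasurableSpace P] [BorelSpace P]
      (h : PseudoRiemannianMetric (𝓡 4) ∞ (EuclideanSpace ℝ (Fin 4)) (TangentSpace (𝓡 4) : P → Type _))
      [h.HasLeviCivita] (hh : h.IsRiemannian) (θ : ℝ),
      (∀ (x : P) (r : NNReal), IsCompact {y : P | h.edist hh x y ≤ r}) →
      (∀ (x : P) (X : TangentSpace (𝓡 4) x), 0 ≤ h.ricci x X X) → 0 < θ →
      (∀ x : P, Tendsto (fun r : ℝ ↦
        ((riemannianMeasure (h.toContMDiffRiemannianMetric hh))
          {y : P | h.edist hh x y ≤ ENNReal.ofReal r}).toReal / (Real.pi ^ 2 / 2 * r ^ 4))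
        atTop (𝓝 θ)) →
      ∀ u : P → ℝ, ContMDiff (𝓡 4) 𝓘(ℝ, ℝ) ∞ u → HasCompactSupport u →
        ∫ x, (u x) ^ 2 ∂(riemannianMeasure (h.toContMDiffRiemannianMetric hh)) = 1 →
        ∀ τ : ℝ, 0 < τ →
          ∫ x, (u x) ^ 2 * Real.log ((u x) ^ 2) ∂(riemannianMeasure (h.toContMDiffRiemannianMetric hh)) ≤
            4 * τ * ∫ x, h.gradSq u x ∂(riemannianMeasure (h.toContMDiffRiemannianMetric hh))
              - Real.log θ - 2 * Real.log (4 * Real.pi * τ) - 4) →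
    (∀ c' : ℝ, 0 < c' → c' ≤ 1 →
      ∃ gc : PseudoRiemannianMetric (𝓡 4) ∞ (EuclideanSpace ℝ (Fin 4))
          (TangentSpace (𝓡 4) : EuclideanSpace ℝ (Fin 4) → Type _),
      ∃ _ : gc.HasLeviCivita, ∃ hgc : gc.IsRiemannian,
        (∀ (x : EuclideanSpace ℝ (Fin 4)) (r : NNReal),
          IsCompact {y : EuclideanSpace ℝ (Fin 4) | gc.edist hgc x y ≤ r}) ∧
        (∀ (x : EuclideanSpace ℝ (Fin 4)) (X : TangentSpace (𝓡 4) x), 0 ≤ gc.ricci x X X) ∧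
        (∀ x : EuclideanSpace ℝ (Fin 4), Tendsto (fun r : ℝ ↦
          ((riemannianMeasure (gc.toContMDiffRiemannianMetric hgc))
            {y : EuclideanSpace ℝ (Fin 4) | gc.edist hgc x y ≤ ENNReal.ofReal r}).toReal /
              (Real.pi ^ 2 / 2 * r ^ 4)) atTop (𝓝 (c' ^ 3))) ∧
        ∀ x : EuclideanSpace ℝ (Fin 4), 1 ≤ ‖x‖ → ∀ v w : EuclideanSpace ℝ (Fin 4),
          gc.val x v w = (c' * ‖x‖ ^ (c' - 1)) ^ 2 * ⟪v, w⟫) →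
    ∀ c' : ℝ, 0 < c' → c' ≤ 1 →
      ∀ u : EuclideanSpace ℝ (Fin 4) → ℝ, ContDiff ℝ ∞ u → HasCompactSupport u →
        tsupport u ⊆ {x | 1 < ‖x‖} →
        ∫ x, (u x) ^ 2 * (c' * ‖x‖ ^ (c' - 1)) ^ 4 = 1 → ∀ τ : ℝ, 0 < τ →
          ∫ x, (u x) ^ 2 * Real.log ((u x) ^ 2) * (c' * ‖x‖ ^ (c' - 1)) ^ 4 ≤
            4 * τ * (∫ x, (c' * ‖x‖ ^ (c' - 1))⁻¹ ^ 2 * ‖gradient u x‖ ^ 2 *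
                (c' * ‖x‖ ^ (c' - 1)) ^ 4)
              - 3 * Real.log c' - 2 * Real.log (4 * Real.pi * τ) - 4 := by
  intro hBKT hmodel c' hc' hc1 u hu huc hus hnorm τ hτ
  obtain ⟨gc, hLC, hgc, hcomplete, hRic, hAVR, hcone⟩ := hmodel c' hc' hc1
  have hLS := hBKT (EuclideanSpace ℝ (Fin 4)) gc hgc (c' ^ 3) hcomplete hRic (pow_pos hc' 3) hAVR
  have hlog : Real.log (c' ^ 3) = 3 * Real.log c' := by
    rw [Real.log_pow]
    norm_num
  rw [hlog] at hLS
  exact AnnulusConeFloor.logSobolev_cone_euclidean gc hgc hc' hcone hLS hu huc hus hnorm hτ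

end Summit.SmoothPoincare4.SmoothPoincare4.Theorems

end
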